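import Literature.Analysis.FluidPDE.Ferrari1993LogEstimateReduction
import HarnessLib

/-!
# Integrals of periodic functions over translates of the period cell and over balls in the cylinder

Topic `Literature/Analysis/FluidPDE`. Support file (all results proved, no named facts, no
definitions) for the interior part of the `δ`-family of `L^∞` div–curl estimates
`ShirotaYanagisawa1993_periodicCylinderDeltaLogDivCurlEstimate` (`PeriodicCylinderLogDivCurl.lean`),
whose far-field / lower-order terms (Ferrari 1993, (37) and (47) pp. 287–288; Tao 2011, §10:
`r^{-5/2} ‖u‖_{L²(2B)}`) are energies of the velocity over balls inside the infinite cylinder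
`{r < 1}`, while the hypotheses of the fact only bound the energy `‖v‖_{L²(cell)}` of one period
cell `cylinderCell L = {r < 1} × (0, L)`. For an `L`-periodic integrand the two are comparable:

* `lintegral_axialTranslate_cylinderCell_eq` — `∫⁻_{cell + c e_z} G = ∫⁻_{cell} G(· + c e_z)`
  (translation invariance of Lebesgue measure), hence `= ∫⁻_{cell} G` for `c = kL` and `G`
  `L`-periodic (`lintegral_intTranslate_cylinderCell_eq`);
* `lintegral_le_mul_lintegral_cylinderCell_of_subset_slab` — a subset of the cylinder lying in the
  slab `jL ≤ z ≤ (j + m)L` has `∫⁻_S G ≤ m ∫⁻_{cell} G` (the `m` cells and the null faces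
  `z = kL` cover the slab);
* `lintegral_ball_le_mul_lintegral_cylinderCell` — for a ball `B(x, R) ⊆ {r < 1}`,
  `∫⁻_{B(x,R)} G ≤ (⌈2R/L⌉₊ + 1) ∫⁻_{cell} G`.

## Mathlib / tree search

Tree: `cylinderCell`, `mem_cylinderCell`, `volume_setOf_apply_two_eq` (the faces are null),
`cylRadius_add_axialShift`, `IsAxiallyPeriodic.add_int_mul`. Mathlib: `lintegral_add_right_eq_self`,
`lintegral_iUnion_le`, `lintegral_union_le`, `setLIntegral_measure_zero`, `Int.floor_le`,
`Int.lt_floor_add_one`, `Nat.le_ceil`.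
-/

noncomputable section

open MeasureTheory Set Function Filter Topology TopologicalSpace Metric
open scoped NNReal ENNReal

namespace Literature.Analysis.FluidPDE

/-! ### Translates of the cell -/

/-- **Integral over an axial translate of the cell**: for any `G : ℝ³ → ℝ≥0∞` and `c : ℝ`,
`∫⁻_{{y | y − c e_z ∈ cell}} G = ∫⁻_{cell} G(· + c e_z)` (translation invariance of Lebesgue
measure, `lintegral_add_right_eq_self`). [folklore] -/
theorem lintegral_axialTranslate_cylinderCell_eq (L c : ℝ) (G : EuclideanSpace ℝ (Fin 3) → ℝ≥0∞) :
    ∫⁻ y in {y : EuclideanSpace ℝ (Fin 3) |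
        y - c • EuclideanSpace.single (2 : Fin 3) (1 : ℝ) ∈ (cylinderCell L : Set _)}, G y =
      ∫⁻ y in (cylinderCell L : Set (EuclideanSpace ℝ (Fin 3))),
        G (y + c • EuclideanSpace.single (2 : Fin 3) (1 : ℝ)) := by
  set e : EuclideanSpace ℝ (Fin 3) := EuclideanSpace.single (2 : Fin 3) (1 : ℝ) with he
  set T : Set (EuclideanSpace ℝ (Fin 3)) := {y | y - c • e ∈ (cylinderCell L : Set _)} with hT
  have hTm : MeasurableSet T :=
    (cylinderCell L).isOpen.measurableSet.preimage (continuous_id.sub continuous_const).measurable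
  rw [← lintegral_indicator hTm, ← lintegral_indicator (cylinderCell L).isOpen.measurableSet,
    ← lintegral_add_right_eq_self (fun y => T.indicator G y) (c • e)]
  congr 1
  funext y
  have hmem : y + c • e ∈ T ↔ y ∈ (cylinderCell L : Set (EuclideanSpace ℝ (Fin 3))) := by
    rw [hT, mem_setOf_eq, add_sub_cancel_right]
  by_cases hy : y ∈ (cylinderCell L : Set (EuclideanSpace ℝ (Fin 3)))
  · rw [indicator_of_mem (hmem.2 hy), indicator_of_mem hy]
  · rw [indicator_of_notMem (fun h => hy (hmem.1 h)), indicator_of_notMem hy]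

/-- **Integral of a periodic function over an integer translate of the cell**: if
`G (y + L e_z) = G y` for all `y`, then `∫⁻_{{y | y − kL e_z ∈ cell}} G = ∫⁻_{cell} G` for every
`k : ℤ`. [folklore] -/
theorem lintegral_intTranslate_cylinderCell_eq {L : ℝ} {G : EuclideanSpace ℝ (Fin 3) → ℝ≥0∞}
    (hG : IsAxiallyPeriodic L G) (k : ℤ) :
    ∫⁻ y in {y : EuclideanSpace ℝ (Fin 3) |
        y - ((k : ℝ) * L) • EuclideanSpace.single (2 : Fin 3) (1 : ℝ) ∈ (cylinderCell L : Set _)},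
        G y =
      ∫⁻ y in (cylinderCell L : Set (EuclideanSpace ℝ (Fin 3))), G y := by
  rw [lintegral_axialTranslate_cylinderCell_eq]
  exact setLIntegral_congr_fun (cylinderCell L).isOpen.measurableSet fun y _ => hG.add_int_mul k y

/-! ### Slabs are covered by cells and null faces -/

/-- A point of the cylinder with `jL ≤ z ≤ (j + m)L` lies in one of the `m` open cells
`{y | y − (j + i)L e_z ∈ cell}`, `i < m`, or on one of the `m + 1` faces `z = (j + i)L`, `i ≤ m`
(`L > 0`). [folklore] -/
theorem mem_iUnion_translate_or_face {L : ℝ} (hL : 0 < L) (j : ℤ) (m : ℕ)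
    {y : EuclideanSpace ℝ (Fin 3)} (hyr : cylRadius y < 1) (hy1 : (j : ℝ) * L ≤ y 2)
    (hy2 : y 2 ≤ ((j : ℝ) + m) * L) :
    y ∈ (⋃ i : Fin m, {y : EuclideanSpace ℝ (Fin 3) |
        y - (((j + (i : ℕ) : ℤ) : ℝ) * L) • EuclideanSpace.single (2 : Fin 3) (1 : ℝ) ∈
          (cylinderCell L : Set _)}) ∪
      ⋃ i : Fin (m + 1), {y : EuclideanSpace ℝ (Fin 3) | y 2 = ((j : ℝ) + (i : ℕ)) * L} := by
  -- the index of the cell containing `y`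
  set i : ℤ := ⌊y 2 / L⌋ - j with hi
  have hfl1 : ((⌊y 2 / L⌋ : ℤ) : ℝ) * L ≤ y 2 := (le_div_iff₀ hL).1 (Int.floor_le _)
  have hfl2 : y 2 < (((⌊y 2 / L⌋ : ℤ) : ℝ) + 1) * L := (div_lt_iff₀ hL).1 (Int.lt_floor_add_one _)
  have hi0 : 0 ≤ i := by
    have : (j : ℝ) * L < (((⌊y 2 / L⌋ : ℤ) : ℝ) + 1) * L := hy1.trans_lt hfl2
    have h' : (j : ℝ) < ((⌊y 2 / L⌋ : ℤ) : ℝ) + 1 := lt_of_mul_lt_mul_right this hL.le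
    have h'' : j < ⌊y 2 / L⌋ + 1 := by exact_mod_cast h'
    omega
  by_cases hface : y 2 = ((⌊y 2 / L⌋ : ℤ) : ℝ) * L
  · -- `y` lies on the face `z = ⌊z/L⌋ L`, of index `i ≤ m`
    have him : i ≤ m := by
      have : ((⌊y 2 / L⌋ : ℤ) : ℝ) * L ≤ ((j : ℝ) + m) * L := hface ▸ hy2
      have h' : ((⌊y 2 / L⌋ : ℤ) : ℝ) ≤ (j : ℝ) + m := le_of_mul_le_mul_right this hL
      have h'' : ⌊y 2 / L⌋ ≤ j + m := by exact_mod_cast h'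
      omega
    refine Or.inr (mem_iUnion.2 ⟨⟨i.toNat, by omega⟩, ?_⟩)
    rw [mem_setOf_eq, hface]
    congr 1
    have : ((i.toNat : ℕ) : ℝ) = (i : ℝ) := by exact_mod_cast Int.toNat_of_nonneg hi0
    rw [this, hi]
    push_cast
    ring
  · -- `y` lies in the open cell of index `i < m`
    have hlt : ((⌊y 2 / L⌋ : ℤ) : ℝ) * L < y 2 := lt_of_le_of_ne hfl1 (Ne.symm hface)
    have him : i < m := by
      have : ((⌊y 2 / L⌋ : ℤ) : ℝ) * L < ((j : ℝ) + m) * L := hlt.trans_le hy2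
      have h' : ((⌊y 2 / L⌋ : ℤ) : ℝ) < (j : ℝ) + m := lt_of_mul_lt_mul_right this hL.le
      have h'' : ⌊y 2 / L⌋ < j + m := by exact_mod_cast h'
      omega
    refine Or.inl (mem_iUnion.2 ⟨⟨i.toNat, by omega⟩, ?_⟩)
    have hcast : ((j + ((i.toNat : ℕ) : ℤ) : ℤ) : ℝ) = ((⌊y 2 / L⌋ : ℤ) : ℝ) := by
      have : ((i.toNat : ℕ) : ℤ) = i := Int.toNat_of_nonneg hi0
      rw [this, hi]
      push_cast
      ring
    rw [mem_setOf_eq, hcast, SetLike.mem_coe, mem_cylinderCell, sub_eq_add_neg, ← neg_smul,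
      cylRadius_add_axialShift]
    refine ⟨hyr, ?_, ?_⟩
    · simp only [PiLp.add_apply, PiLp.smul_apply, EuclideanSpace.single, PiLp.single_apply, if_true,
        smul_eq_mul, mul_one]
      linarith
    · simp only [PiLp.add_apply, PiLp.smul_apply, EuclideanSpace.single, PiLp.single_apply, if_true,
        smul_eq_mul, mul_one]
      linarith

/-- **A subset of the cylinder inside the slab `jL ≤ z ≤ (j + m)L` carries at most `m` cells'
worth of a periodic integrand**: `∫⁻_S G ≤ m ∫⁻_{cell} G` for `G` `L`-periodic (`L > 0`).
[folklore] -/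
theorem lintegral_le_mul_lintegral_cylinderCell_of_subset_slab {L : ℝ} (hL : 0 < L)
    {G : EuclideanSpace ℝ (Fin 3) → ℝ≥0∞} (hG : IsAxiallyPeriodic L G) (j : ℤ) (m : ℕ)
    {S : Set (EuclideanSpace ℝ (Fin 3))}
    (hS : ∀ y ∈ S, cylRadius y < 1 ∧ (j : ℝ) * L ≤ y 2 ∧ y 2 ≤ ((j : ℝ) + m) * L) :
    ∫⁻ y in S, G y ≤
      (m : ℝ≥0∞) * ∫⁻ y in (cylinderCell L : Set (EuclideanSpace ℝ (Fin 3))), G y := by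
  set e : EuclideanSpace ℝ (Fin 3) := EuclideanSpace.single (2 : Fin 3) (1 : ℝ) with he
  set T : Fin m → Set (EuclideanSpace ℝ (Fin 3)) := fun i =>
    {y | y - (((j + (i : ℕ) : ℤ) : ℝ) * L) • e ∈ (cylinderCell L : Set _)} with hT
  set N : Fin (m + 1) → Set (EuclideanSpace ℝ (Fin 3)) := fun i =>
    {y | y 2 = ((j : ℝ) + (i : ℕ)) * L} with hN
  have hcover : S ⊆ (⋃ i, T i) ∪ ⋃ i, N i := fun y hy =>
    mem_iUnion_translate_or_face hL j m (hS y hy).1 (hS y hy).2.1 (hS y hy).2.2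
  have hNull : volume (⋃ i, N i) = 0 :=
    measure_iUnion_null fun i => volume_setOf_apply_two_eq _
  calc ∫⁻ y in S, G y ≤ ∫⁻ y in (⋃ i, T i) ∪ ⋃ i, N i, G y := lintegral_mono_set hcover
    _ ≤ (∫⁻ y in ⋃ i, T i, G y) + ∫⁻ y in ⋃ i, N i, G y := lintegral_union_le _ _ _
    _ = ∫⁻ y in ⋃ i, T i, G y := by rw [setLIntegral_measure_zero _ _ hNull, add_zero]
    _ ≤ ∑' i, ∫⁻ y in T i, G y := lintegral_iUnion_le _ _
    _ = ∑ i : Fin m, ∫⁻ y in (cylinderCell L : Set (EuclideanSpace ℝ (Fin 3))), G y := by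
        rw [tsum_fintype]
        exact Finset.sum_congr rfl fun i _ => lintegral_intTranslate_cylinderCell_eq hG _
    _ = (m : ℝ≥0∞) * ∫⁻ y in (cylinderCell L : Set (EuclideanSpace ℝ (Fin 3))), G y := by
        rw [Finset.sum_const, Finset.card_univ, Fintype.card_fin, nsmul_eq_mul]

/-! ### Balls inside the cylinder -/

/-- **A ball inside the cylinder carries at most `⌈2R/L⌉ + 1` cells' worth of a periodic
integrand**: if `B(x, R) ⊆ {r < 1}` and `G` is `L`-periodic (`L > 0`), then
`∫⁻_{B(x,R)} G ≤ (⌈2R/L⌉₊ + 1) ∫⁻_{cell} G` (the ball lies in the slab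
`jL ≤ z ≤ (j + m)L` with `j = ⌊(z(x) − R)/L⌋`, `m = ⌈2R/L⌉₊ + 1`). In particular the energy of a
periodic field over such a ball is bounded by a multiple of its energy over one cell. [folklore] -/
theorem lintegral_ball_le_mul_lintegral_cylinderCell {L : ℝ} (hL : 0 < L)
    {G : EuclideanSpace ℝ (Fin 3) → ℝ≥0∞} (hG : IsAxiallyPeriodic L G)
    {x : EuclideanSpace ℝ (Fin 3)} {R : ℝ}
    (hB : ball x R ⊆ (unitCylinder : Set (EuclideanSpace ℝ (Fin 3)))) :
    ∫⁻ y in ball x R, G y ≤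
      ((⌈2 * R / L⌉₊ + 1 : ℕ) : ℝ≥0∞) *
        ∫⁻ y in (cylinderCell L : Set (EuclideanSpace ℝ (Fin 3))), G y := by
  set j : ℤ := ⌊(x 2 - R) / L⌋ with hj
  set m : ℕ := ⌈2 * R / L⌉₊ + 1 with hm
  refine lintegral_le_mul_lintegral_cylinderCell_of_subset_slab hL hG j m fun y hy => ?_
  have hyr : cylRadius y < 1 := hB hy
  have hdist : |y 2 - x 2| ≤ ‖y - x‖ := by
    simpa [Real.norm_eq_abs] using PiLp.norm_apply_le (p := 2) (y - x) 2
  have hyx : ‖y - x‖ < R := mem_ball_iff_norm.1 hy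
  have h1 := (abs_le.1 (hdist.trans hyx.le)).1
  have h2 := (abs_le.1 (hdist.trans hyx.le)).2
  have hj1 : (j : ℝ) * L ≤ x 2 - R := (le_div_iff₀ hL).1 (Int.floor_le _)
  have hj2 : x 2 - R < ((j : ℝ) + 1) * L := (div_lt_iff₀ hL).1 (Int.lt_floor_add_one _)
  have hceil : 2 * R / L ≤ (⌈2 * R / L⌉₊ : ℝ) := Nat.le_ceil _
  have hceil' : 2 * R ≤ (⌈2 * R / L⌉₊ : ℝ) * L := by
    rw [div_le_iff₀ hL] at hceil
    exact hceil
  refine ⟨hyr, by linarith, ?_⟩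
  rw [hm]
  push_cast
  nlinarith

end Literature.Analysis.FluidPDE
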